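import Summits.BirchSwinnertonDyer.BirchSwinnertonDyer.Theorems.KimAtThreeDeepLowerOffStratumLevelLoweringMultiStabConditionOne
import HarnessLib

/-!
# Route `KimAtThreeKolyvagin` (rung W2), crux `DeepLowerAtThreeOffKatoStratum` (item 19679), registered
# stub `stub_nonAdditive`, ROAD (b^k,add): the `ℓ`-DEPLETION `ι₁ G − a_ℓ(G) ι_ℓ G` of a normalised eigenform at a
# prime `ℓ` DIVIDING its level — Hecke data and VATSAL'S CONDITION 1 (inherited when `a_ℓ(G) ≠ 0`)

Cell `bsd-addord`, seat `bsd-addord-w2-acc2`, gen 7; item `stmt-BirchSwinnertonDyer-19679` (`--supports`, closes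
nothing). On the rows of the stub with an ADDITIVE place `ℓ ≠ 3` of Kodaira type `IV`/`IV*` the optimal level
`N(ρ̄)·3^δ` carries `ℓ^{f_ℓ − 1}` (fact `ribet1990_levelLowering_gamma0_newform_at_three_additiveDrop`), so the level-
lowered newform `g`, and every form `G` of its Hecke family built so far, has `ℓ ∣ level(G)` with `U_ℓ G = a_ℓ(G) G`,
while `a_ℓ(f_E) = 0`. The comparison form is the `ℓ`-DEPLETION `h = ι₁ G − a_ℓ(G) ι_ℓ G ∈ S₂(Γ₀(Nℓ))`: `U_ℓ h = 0`
(`U_ℓ ι₁ = ι₁ U_ℓ`, `U_ℓ ι_ℓ = ι₁` at `ℓ ∣ N`), `T_p h = a_p(G) h` (`p ≠ ℓ`), `a₁(h) = 1`, coefficients in those of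
`G`. Vatsal's Condition 1 passes from `G` to `h` exactly as in the stabilisation step
(`…MultiStabConditionOne`) PROVIDED `a_ℓ(G) ≠ 0`: the `ℓ`-old plane of a `U_ℓ`-eigenvector `v` (eigenvalue `a`) is
`ℂ(ι₁v − aι_ℓv) ⊕ ℂ ι₁v` with `U_ℓ`-eigenvalues `0 ≠ a` (for `a = 0` it is a Jordan block and Condition 1 fails —
this happens iff `ℓ² ∣ level(G)`, i.e. only at `ℓ = 2` with `f₂ ≥ 3`). Theorems only; no definition, no fact.

* §1 `heckeT_deplete_of_heckeT_eq_smul` (`U_ℓ(ι₁v − tι_ℓv) = (a − t)ι₁v`), `heckeT_iota_one_of_dvd`,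
  `isHeckeEigenform_deplete`, `heckeEigenvalue_deplete`, `valuation_cuspCoeff_stab_le_one_of_le`,
  `coeffField_stab_le_of_mem`.
* §2 ★ `hasSimpleHeckeGenEigenspace_deplete_of_hasSimpleHeckeGenEigenspace`.
[cite: Vatsal1999, (1.2) Condition 1] [cite: DiamondShurman2005, Prop. 5.6.2, §5.7, Thm. 5.8.3] [cite: AtkinLehner1970, Thm. 3, Thm. 5]
-/

set_option autoImplicit false
-- the Theorems namespace of a single-conjunct summit repeats the summit name by design (D-0017)
set_option linter.dupNamespace false

noncomputable section

open scoped MatrixGroups ModularForm Classical NNReal IntermediateField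

open CongruenceSubgroup WeierstrassCurve Literature.NumberTheory.EllipticCurves
  Literature.NumberTheory.EllipticCurves.ModularForms
open UpperHalfPlane hiding I

namespace Summit.BirchSwinnertonDyer.BirchSwinnertonDyer.Theorems.KimAtThreeDeepLowerOffStratumLevelLoweringDepleteConditionOne

open Summit.BirchSwinnertonDyer.BirchSwinnertonDyer.Theorems.KimAtThreeDeepLowerOffStratumLevelLoweringConditionOne
open Summit.BirchSwinnertonDyer.BirchSwinnertonDyer.Theorems.KimAtThreeDeepLowerOffStratumLevelLoweringVatsal (valuation_le_one_iff)
open Summit.BirchSwinnertonDyer.BirchSwinnertonDyer.Theorems.KimAtThreeDeepLowerOffStratumLevelLoweringVatsalStab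
  (cuspCoeff_stab isNormalized_stab)
open Summit.BirchSwinnertonDyer.BirchSwinnertonDyer.Theorems.KimAtThreeDeepLowerOffStratumLevelLoweringStabEigenform
  renaming heckeT_stab_of_ne → heckeT_stab_of_ne_eig, heckeT_stab_self → heckeT_stab_self_eig,
    isHeckeEigenform_stab → isHeckeEigenform_stab_eig, cuspCoeff_stab_prime → cuspCoeff_stab_prime_eig,
    cuspCoeff_mul_cuspCoeff → cuspCoeff_mul_cuspCoeff_eig, heckeEigenvalue_stab → heckeEigenvalue_stab_eig
open Summit.BirchSwinnertonDyer.BirchSwinnertonDyer.Theorems.KimAtThreeDeepLowerOffStratumLevelLoweringDoubleStabConditionOne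
  (iota_iota)
open Summit.BirchSwinnertonDyer.BirchSwinnertonDyer.Theorems.KimAtThreeDeepLowerOffStratumLevelLoweringMultiStabConditionOne

/-! ### §1 `U_ℓ` on the `ℓ`-old plane when `ℓ` divides the level; Hecke data of the depletion -/

section Operators

variable {N ℓ : ℕ} [NeZero N] [NeZero ℓ] (h1 : N * 1 ∣ N * ℓ) (hℓℓ : N * ℓ ∣ N * ℓ)

/-- **`U_ℓ ι₁ v = ι₁ U_ℓ v` at `ℓ ∣ N`** (the operator is `U_ℓ` at both levels; Diamond–Shurman Prop. 5.6.2).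
[cite: DiamondShurman2005, Prop. 5.6.2 (proof, first diagram)] -/
theorem heckeT_iota_one_of_dvd (hℓ : ℓ.Prime) (hℓN : ℓ ∣ N) (v : CuspForm (Gamma0 N) 2) :
    heckeT (Gamma0 (N * ℓ)) 2 ℓ (iota N (N * ℓ) 1 2 h1 v) = iota N (N * ℓ) 1 2 h1 (heckeT (Gamma0 N) 2 ℓ v) :=
  heckeT_iota_of_not_dvd h1 hℓ hℓ.not_dvd_one ⟨fun _ ↦ dvd_mul_left ℓ N, fun _ ↦ hℓN⟩ v

/-- **`U_ℓ (ι₁ v − t ι_ℓ v) = (a − t)·ι₁ v`** for a `U_ℓ`-eigenvector `v ∈ S₂(Γ₀(N))` with eigenvalue `a`, `ℓ ∣ N`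
prime: `U_ℓ ι₁ = ι₁ U_ℓ` and `U_ℓ ι_ℓ = ι₁` (Diamond–Shurman Prop. 5.6.2). In particular the DEPLETION
`t = a` is killed by `U_ℓ`. [cite: DiamondShurman2005, Prop. 5.6.2 (proof, both diagrams)] -/
theorem heckeT_deplete_of_heckeT_eq_smul (hℓ : ℓ.Prime) (hℓN : ℓ ∣ N) {v : CuspForm (Gamma0 N) 2} {a : ℂ}
    (hv : heckeT (Gamma0 N) 2 ℓ v = a • v) (t : ℂ) :
    heckeT (Gamma0 (N * ℓ)) 2 ℓ (iota N (N * ℓ) 1 2 h1 v - t • iota N (N * ℓ) ℓ 2 hℓℓ v) =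
      (a - t) • iota N (N * ℓ) 1 2 h1 v := by
  have h3 : N * (ℓ * 1) ∣ N * ℓ := by rw [mul_one]
  have hUℓ : heckeT (Gamma0 (N * ℓ)) 2 ℓ (iota N (N * ℓ) ℓ 2 hℓℓ v) = iota N (N * ℓ) 1 2 h1 v := by
    rw [← iota_congr (mul_one ℓ) h3 hℓℓ v]
    exact heckeT_iota_mul h3 h1 hℓ (dvd_mul_left ℓ N) v
  rw [map_sub, map_smul, heckeT_iota_one_of_dvd h1 hℓ hℓN v, hv, map_smul, hUℓ, sub_smul]

variable {G : CuspForm (Gamma0 N) 2} (hGeig : IsHeckeEigenform G) (hGnorm : IsNormalized G)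
include hGeig hGnorm

/-- **The `ℓ`-depletion `ι₁ G − a_ℓ(G) ι_ℓ G` of a normalised eigenform is a Hecke eigenform at level `Nℓ`**
(`ℓ ∣ N`): `T_p` for `p ≠ ℓ` by `…StabEigenform.heckeT_stab_of_ne`, `U_ℓ` with eigenvalue `0`.
[cite: DiamondShurman2005, Prop. 5.6.2 and §5.7] -/
theorem isHeckeEigenform_deplete (hℓ : ℓ.Prime) (hℓN : ℓ ∣ N) :
    IsHeckeEigenform (iota N (N * ℓ) 1 2 h1 G - cuspCoeff G ℓ • iota N (N * ℓ) ℓ 2 hℓℓ G) := by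
  intro p hp
  haveI : NeZero p := ⟨hp.ne_zero⟩
  by_cases hpℓ : p = ℓ
  · subst hpℓ
    refine ⟨0, ?_⟩
    have hv : heckeT (Gamma0 N) 2 p G = cuspCoeff G p • G := by
      rw [heckeT_eq_heckeEigenvalue_smul G p (hGeig p hp), heckeEigenvalue_eq_coeff_of_isNormalized hGnorm hp (hGeig p hp)]
      rfl
    rw [heckeT_deplete_of_heckeT_eq_smul h1 hℓℓ hp hℓN hv, sub_self, zero_smul, zero_smul]
  · exact ⟨_, heckeT_stab_of_ne_eig hGeig hGnorm (cuspCoeff G ℓ) h1 hℓℓ hℓ hp hpℓ⟩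

/-- The Hecke eigenvalues of the depletion: `0` at `ℓ`, `a_p(G)` at `p ≠ ℓ`. [cite: DiamondShurman2005, §5.7] -/
theorem heckeEigenvalue_deplete (hℓ : ℓ.Prime) (hℓN : ℓ ∣ N) {p : ℕ} (hp : p.Prime) :
    heckeEigenvalue (iota N (N * ℓ) 1 2 h1 G - cuspCoeff G ℓ • iota N (N * ℓ) ℓ 2 hℓℓ G) p =
      if p = ℓ then 0 else cuspCoeff G p := by
  rw [heckeEigenvalue_eq_coeff_of_isNormalized (isNormalized_stab G (cuspCoeff G ℓ) h1 hℓℓ hGnorm hℓ) hp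
    (isHeckeEigenform_deplete h1 hℓℓ hGeig hGnorm hℓ hℓN p hp)]
  have h := cuspCoeff_stab_prime_eig hGnorm (cuspCoeff G ℓ) h1 hℓℓ hℓ hp
  rw [sub_self] at h
  exact h

omit [NeZero N] hGeig hGnorm in
/-- The coefficients of `ι₁ G − t ι_ℓ G` are `3`-integral when those of `G` are and `t` is (no Hecke polynomial
needed). [folklore] -/
theorem valuation_cuspCoeff_stab_le_one_of_le (ι : PadicAlgCl 3 ≃+* ℂ) {t : ℂ}
    (hint : ∀ n : ℕ, Valued.v (ι.symm (cuspCoeff G n)) ≤ 1) (ht : Valued.v (ι.symm t) ≤ 1) (n : ℕ) :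
    Valued.v (ι.symm (cuspCoeff (iota N (N * ℓ) 1 2 h1 G - t • iota N (N * ℓ) ℓ 2 hℓℓ G) n)) ≤ 1 := by
  rw [cuspCoeff_stab G t h1 hℓℓ n, map_sub, map_mul, sub_eq_add_neg]
  refine valuation_le_one_iff.mpr ((PadicAlgCl.isNonarchimedean 3 _ _).trans (max_le ?_ ?_))
  · exact valuation_le_one_iff.mp (hint n)
  · rw [norm_neg, norm_mul]
    refine mul_le_one₀ (valuation_le_one_iff.mp ht) (norm_nonneg _) ?_
    by_cases hℓn : ℓ ∣ n
    · rw [if_pos hℓn]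
      exact valuation_le_one_iff.mp (hint _)
    · rw [if_neg hℓn, map_zero, norm_zero]
      exact zero_le_one

omit [NeZero N] hGeig hGnorm in
/-- The coefficient field of `ι₁ G − t ι_ℓ G` lies in that of `G` when `t ∈ K_G`; in particular it is a number
field when `K_G` is. [folklore] -/
theorem finiteDimensional_coeffField_stab_of_mem (hfd : FiniteDimensional ℚ (coeffField G)) {t : ℂ}
    (ht : t ∈ coeffField G) :
    FiniteDimensional ℚ (coeffField (iota N (N * ℓ) 1 2 h1 G - t • iota N (N * ℓ) ℓ 2 hℓℓ G)) := by
  have hle : coeffField (iota N (N * ℓ) 1 2 h1 G - t • iota N (N * ℓ) ℓ 2 hℓℓ G) ≤ coeffField G := by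
    rw [coeffField, IntermediateField.adjoin_le_iff]
    rintro _ ⟨n, rfl⟩
    show (qExpansion 1 ⇑(iota N (N * ℓ) 1 2 h1 G - t • iota N (N * ℓ) ℓ 2 hℓℓ G)).coeff n ∈ coeffField G
    have hco := cuspCoeff_stab G t h1 hℓℓ n
    rw [cuspCoeff] at hco
    rw [hco]
    refine sub_mem (coeff_mem_coeffField G n) (mul_mem ht ?_)
    split_ifs
    · exact coeff_mem_coeffField G _
    · exact zero_mem _
  haveI := hfd
  exact FiniteDimensional.of_injective (IntermediateField.inclusion hle).toLinearMap
    (IntermediateField.inclusion_injective hle)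

end Operators

/-! ### §2 The depletion step: Condition 1 passes from `G` to `ι₁ G − a_ℓ(G) ι_ℓ G` when `a_ℓ(G) ≠ 0` -/

section Step

variable {M₀ N ℓ : ℕ} [NeZero M₀] [NeZero N] [NeZero ℓ] {g : CuspForm (Gamma0 M₀) 2} (hg : IsNewform0 g)
  (h1 : N * 1 ∣ N * ℓ) (hℓℓ : N * ℓ ∣ N * ℓ)
include hg

/-- ★ **Condition 1 is inherited by the `ℓ`-depletion.** Let `g ∈ S₂(Γ₀(M₀))` be a newform, `N = M₀ R` with
`ℓ ∣ M₀` prime and `ℓ ∤ R`, and `G ∈ S₂(Γ₀(N))` a normalised Hecke eigenform with `a_p(G) = a_p(g)` for every prime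
`p ∤ N` and for `p = ℓ`, satisfying Vatsal's Condition 1. If `a_ℓ(G) ≠ 0` then `ι₁ G − a_ℓ(G) ι_ℓ G ∈ S₂(Γ₀(Nℓ))`
satisfies Condition 1: a generalised eigenvector lies (Atkin–Lehner + strong multiplicity one) in the span of the
old forms `ι_d g`, `d ∣ Rℓ`, hence in `S₀ V + ι₁ V` with `V` the `U_ℓ`-eigenspace of `a = a_ℓ(G)` at level `N`
and `S₀ = ι₁ − aι_ℓ`; there `U_ℓ` has the eigenvalues `0` (on `S₀ V`) and `a ≠ 0` (on `ι₁ V`), so a power of `U_ℓ`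
kills only `S₀ V`, and `S₀` is injective and intertwines the other Hecke operators.
[cite: Vatsal1999, (1.2) Condition 1] [cite: AtkinLehner1970, Thm. 4 and Thm. 5]
[cite: DiamondShurman2005, Prop. 5.6.2 and Thm. 5.8.3] -/
theorem hasSimpleHeckeGenEigenspace_deplete_of_hasSimpleHeckeGenEigenspace {R : ℕ} (hNR : N = M₀ * R)
    {G : CuspForm (Gamma0 N) 2} (hGeig : IsHeckeEigenform G) (hGnorm : IsNormalized G)
    (hGC : HasSimpleHeckeGenEigenspace G) (hGg : ∀ p : ℕ, p.Prime → ¬ p ∣ N → cuspCoeff G p = cuspCoeff g p)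
    (hℓ : ℓ.Prime) (hℓM₀ : ℓ ∣ M₀) (hℓR : ¬ ℓ ∣ R) (hGℓ : cuspCoeff G ℓ = cuspCoeff g ℓ) (hne : cuspCoeff G ℓ ≠ 0) :
    HasSimpleHeckeGenEigenspace (iota N (N * ℓ) 1 2 h1 G - cuspCoeff G ℓ • iota N (N * ℓ) ℓ 2 hℓℓ G) := by
  set a : ℂ := cuspCoeff G ℓ with hadef
  have hℓN : ℓ ∣ N := by rw [hNR]; exact hℓM₀.mul_right R
  have hM₀N : M₀ ∣ N := by rw [hNR]; exact dvd_mul_right M₀ R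
  haveI : NeZero R := ⟨fun h ↦ NeZero.ne N (by rw [hNR, h, mul_zero])⟩
  -- the two maps `S₀ = ι₁ − a ι_ℓ`, `S₁ = ι₁`
  set S₀ : CuspForm (Gamma0 N) 2 →ₗ[ℂ] CuspForm (Gamma0 (N * ℓ)) 2 :=
    iota N (N * ℓ) 1 2 h1 - a • iota N (N * ℓ) ℓ 2 hℓℓ with hS₀
  set S₁ : CuspForm (Gamma0 N) 2 →ₗ[ℂ] CuspForm (Gamma0 (N * ℓ)) 2 := iota N (N * ℓ) 1 2 h1 with hS₁
  have hS₀v : ∀ v, S₀ v = iota N (N * ℓ) 1 2 h1 v - a • iota N (N * ℓ) ℓ 2 hℓℓ v := fun v ↦ rfl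
  have hS₁v : ∀ v, S₁ v = iota N (N * ℓ) 1 2 h1 v := fun v ↦ rfl
  have hev : ∀ {p : ℕ}, p.Prime → heckeEigenvalue (iota N (N * ℓ) 1 2 h1 G - a • iota N (N * ℓ) ℓ 2 hℓℓ G) p =
      if p = ℓ then 0 else cuspCoeff G p :=
    fun hp ↦ heckeEigenvalue_deplete h1 hℓℓ hGeig hGnorm hℓ hℓN hp
  change ∀ k : CuspForm (Gamma0 (N * ℓ)) 2, _ → ∃ c : ℂ, k = c • S₀ G
  intro k hk
  by_cases hk0 : k = 0
  · exact ⟨0, by rw [hk0, zero_smul]⟩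
  -- off `Nℓ` the generalised eigen-equations are honest, with eigenvalues `a_p(g)`
  have hT : ∀ (p : ℕ) (hp : p.Prime), ¬ p ∣ N * ℓ →
      (haveI : NeZero p := ⟨hp.ne_zero⟩; heckeT (Gamma0 (N * ℓ)) 2 p k) = (qExpansion 1 ⇑g).coeff p • k := by
    intro p hp hpNℓ
    haveI : NeZero p := ⟨hp.ne_zero⟩
    have hpℓ : p ≠ ℓ := by rintro rfl; exact hpNℓ (dvd_mul_left p N)
    have hpN : ¬ p ∣ N := fun h ↦ hpNℓ (h.mul_right ℓ)
    obtain ⟨n, hn⟩ := hk p hp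
    rw [hev hp, if_neg hpℓ, hGg p hp hpN] at hn
    exact heckeT_apply_eq_smul_of_pow_apply_eq_zero hp hpNℓ hn
  obtain ⟨M', _, hM'N, g₁, hg₁, hcoef, hmem⟩ := exists_isNewform0_mem_span_of_eigenpacket hk0 hT
  -- strong multiplicity one: `M' = M₀`, `g₁ = g`
  have hfg : ∀ p : ℕ, p.Prime → ¬ p ∣ N * ℓ → heckeEigenvalue g p = heckeEigenvalue g₁ p := by
    intro p hp hpN
    rw [heckeEigenvalue_eq_coeff_of_isNormalized hg.2.2 hp (hg.2.1 p hp),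
      heckeEigenvalue_eq_coeff_of_isNormalized hg₁.2.2 hp (hg₁.2.1 p hp), hcoef p hp hpN]
  have hfin : {p : ℕ | p.Prime ∧ heckeEigenvalue g p ≠ heckeEigenvalue g₁ p}.Finite :=
    finite_setOf_prime_and_ne (NeZero.ne (N * ℓ)) hfg
  have hMM' : M₀ = M' := IsNewform0.level_eq_of_heckeEigenvalue_eq_holds hg hg₁ hfin
  subst hMM'
  have hg₁g : g₁ = g := (IsNewform0.eq_of_heckeEigenvalue_eq_holds hg hg₁ hfin).symm
  rw [hg₁g] at hmem
  -- the `U_ℓ`-eigenspace `V ⊆ S₂(Γ₀(N))` for `a` and the target space `P = S₀ V + S₁ V`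
  set V : Submodule ℂ (CuspForm (Gamma0 N) 2) := Module.End.eigenspace (heckeT (Gamma0 N) 2 ℓ) a with hVdef
  have hV : ∀ {v : CuspForm (Gamma0 N) 2}, v ∈ V ↔ heckeT (Gamma0 N) 2 ℓ v = a • v :=
    Module.End.mem_eigenspace_iff
  set P : Submodule ℂ (CuspForm (Gamma0 (N * ℓ)) 2) := V.map S₀ ⊔ V.map S₁ with hPdef
  have hι1 : ∀ v ∈ V, iota N (N * ℓ) 1 2 h1 v ∈ P := fun v hv ↦ Submodule.mem_sup_right ⟨v, hv, rfl⟩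
  have hιℓ : ∀ v ∈ V, iota N (N * ℓ) ℓ 2 hℓℓ v ∈ P := by
    intro v hv
    have he : iota N (N * ℓ) ℓ 2 hℓℓ v = a⁻¹ • (S₁ v - S₀ v) := by
      rw [hS₀v, hS₁v, sub_sub_cancel, smul_smul, inv_mul_cancel₀ hne, one_smul]
    rw [he]
    exact P.smul_mem _ (P.sub_mem (Submodule.mem_sup_right ⟨v, hv, rfl⟩) (Submodule.mem_sup_left ⟨v, hv, rfl⟩))
  -- the old forms `ι_d g`, `M₀ d ∣ N`, `ℓ ∤ d`, lie in `V` (`U_ℓ ι_d = ι_d U_ℓ`, `U_ℓ g = a_ℓ(g) g = a g`)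
  have hιV : ∀ {d : ℕ} [NeZero d] (hd : M₀ * d ∣ N), ¬ ℓ ∣ d → iota M₀ N d 2 hd g ∈ V := by
    intro d _ hd hℓd
    rw [hV, heckeT_iota_of_not_dvd hd hℓ hℓd ⟨fun _ ↦ hℓN, fun _ ↦ hℓM₀⟩, hg.heckeT_eq_coeff_smul hℓ, map_smul, hGℓ]
    rfl
  -- the `(Nℓ/M₀)`-old forms of `g` lie in `P`
  have hle : Submodule.span ℂ
      {v | ∃ (d : ℕ) (_ : NeZero d), M₀ * d ∣ N * ℓ ∧ v = degeneracyMap0 M₀ (N * ℓ) d 2 g} ≤ P := by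
    refine Submodule.span_le.mpr ?_
    rintro _ ⟨d, _, hd, rfl⟩
    rw [SetLike.mem_coe, degeneracyMap0_eq_smul_iota M₀ (N * ℓ) d 2 hd]
    refine P.smul_mem _ ?_
    -- `d ∣ R ℓ`
    have hdRℓ : d ∣ R * ℓ := by
      have h' : M₀ * d ∣ M₀ * (R * ℓ) := by rw [← mul_assoc, ← hNR]; exact hd
      exact Nat.dvd_of_mul_dvd_mul_left (NeZero.pos M₀) h'
    by_cases hℓd : ℓ ∣ d
    · -- `d = ℓ e`, `e ∣ R`, `ℓ ∤ e`: `ι_d g = ι_ℓ (ι_e g)`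
      obtain ⟨e, rfl⟩ := hℓd
      haveI : NeZero e := ⟨fun h ↦ NeZero.ne (ℓ * e) (by rw [h, mul_zero])⟩
      have heR : e ∣ R := by
        have : e * ℓ ∣ R * ℓ := by rw [mul_comm e ℓ]; exact hdRℓ
        exact Nat.dvd_of_mul_dvd_mul_right (NeZero.pos ℓ) this
      have hℓe : ¬ ℓ ∣ e := fun h ↦ hℓR (h.trans heR)
      have he : M₀ * e ∣ N := by rw [hNR]; exact mul_dvd_mul_left M₀ heR
      have hd' : M₀ * (e * ℓ) ∣ N * ℓ := by simpa only [mul_comm] using hd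
      rw [iota_congr (mul_comm ℓ e) hd hd' g, ← iota_iota (L := M₀) (M := N) (e := e) (d := ℓ) he hℓℓ hd' g]
      exact hιℓ _ (hιV he hℓe)
    · -- `ℓ ∤ d`, `d ∣ R`: `ι_d g = ι₁ (ι_d g)`
      have hdR : d ∣ R := ((Nat.Prime.coprime_iff_not_dvd hℓ).mpr hℓd).symm.dvd_of_dvd_mul_right hdRℓ
      have hd' : M₀ * d ∣ N := by rw [hNR]; exact mul_dvd_mul_left M₀ hdR
      have hd'' : M₀ * (d * 1) ∣ N * ℓ := by rw [mul_one]; exact hd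
      rw [iota_congr (mul_one d).symm hd hd'' g, ← iota_iota (L := M₀) (M := N) (e := d) (d := 1) hd' h1 hd'' g]
      exact hι1 _ (hιV hd' hℓd)
  -- coordinates: `k = S₀ w₁ + S₁ w₂` with `w₁, w₂ ∈ V`
  obtain ⟨y, hy, z, hz, hyz⟩ := Submodule.mem_sup.mp (hle hmem)
  obtain ⟨w₁, hw₁, rfl⟩ := Submodule.mem_map.mp hy
  obtain ⟨w₂, hw₂, rfl⟩ := Submodule.mem_map.mp hz
  have hU₀ : heckeT (Gamma0 (N * ℓ)) 2 ℓ (S₀ w₁) = (0 : ℂ) • S₀ w₁ := by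
    rw [hS₀v, heckeT_deplete_of_heckeT_eq_smul h1 hℓℓ hℓ hℓN (hV.mp hw₁) a, sub_self, zero_smul, zero_smul]
  have hU₁ : heckeT (Gamma0 (N * ℓ)) 2 ℓ (S₁ w₂) = a • S₁ w₂ := by
    rw [hS₁v, heckeT_iota_one_of_dvd h1 hℓ hℓN w₂, hV.mp hw₂, map_smul]
  -- a power of `U_ℓ − 0` kills `k`: its `S₁`-component vanishes
  obtain ⟨m, hm⟩ := hk ℓ hℓ
  rw [hev hℓ, if_pos rfl] at hm
  rcases Nat.eq_zero_or_pos m with rfl | hmpos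
  · rw [pow_zero, Module.End.one_apply] at hm
    exact absurd hm hk0
  have hS₁0 : S₁ w₂ = 0 := by
    rw [← hyz, map_add, pow_sub_smul_one_apply_of_eigen _ hU₀ _ m, pow_sub_smul_one_apply_of_eigen _ hU₁ _ m,
      sub_self, zero_pow hmpos.ne', zero_smul, zero_add, sub_zero, smul_eq_zero] at hm
    exact hm.resolve_left (pow_ne_zero _ hne)
  have hk₁ : k = S₀ w₁ := by rw [← hyz, hS₁0, add_zero]
  -- `w₁` is a generalised eigenvector for the eigencharacter of `G` at level `N`
  have hw₁ev : ∀ p : ℕ, (hp : p.Prime) → ∃ n : ℕ,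
      (haveI : NeZero p := ⟨hp.ne_zero⟩;
        ((heckeT (Gamma0 N) 2 p - heckeEigenvalue G p • (1 : Module.End ℂ (CuspForm (Gamma0 N) 2))) ^ n) w₁) =
        0 := by
    intro p hp
    haveI : NeZero p := ⟨hp.ne_zero⟩
    have hevG : heckeEigenvalue G p = cuspCoeff G p :=
      heckeEigenvalue_eq_coeff_of_isNormalized hGnorm hp (hGeig p hp)
    by_cases hpℓ : p = ℓ
    · subst hpℓ
      refine ⟨1, ?_⟩
      rw [pow_one, LinearMap.sub_apply, LinearMap.smul_apply, Module.End.one_apply, hV.mp hw₁, hevG, sub_self]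
    · obtain ⟨n, hn⟩ := hk p hp
      rw [hev hp, if_neg hpℓ, hk₁, ← hevG,
        pow_sub_smul_one_apply_comm S₀ (heckeT (Gamma0 N) 2 p) (heckeT (Gamma0 (N * ℓ)) 2 p)
          (fun v ↦ heckeT_stab_comm h1 hℓℓ hℓ hp hpℓ v a) (heckeEigenvalue G p) n w₁, hS₀v] at hn
      exact ⟨n, eq_zero_of_stab_eq_zero h1 hℓℓ hℓ _ a hn⟩
  obtain ⟨c, hc⟩ := hGC w₁ hw₁ev
  exact ⟨c, by rw [hk₁, hc, map_smul]⟩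

end Step

end Summit.BirchSwinnertonDyer.BirchSwinnertonDyer.Theorems.KimAtThreeDeepLowerOffStratumLevelLoweringDepleteConditionOne

end
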